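import Literature.NumberTheory.Sieve.LargestPrimeFactorCubicLnuSeries
import HarnessLib

/-!
# Heath-Brown 2001 (PLMS), §7 p. 27: the size of `l(d)` — `|l(d)| ≤ 2^{ω(d)} ≤ τ(d)` and
# `l(d) ≪ d^ε e^{−1}` for `d = ef²`

Topic `Literature/NumberTheory/Sieve`; a PROVED arithmetic layer (two definitions with bodies, no named
facts) under the named fact `Irving2015_largestPrimeFactor_cubic` (`LargestPrimeFactorCubic.lean`), input of
the estimates (7.8)–(7.15) of **Lemma 7**.  Source: D. R. Heath-Brown, *The largest prime factor of
`X³ + 2`*, Proc. London Math. Soc. (3) 82 (2001) 554–596, §7 p. 27: "Since `l(d)` is supported on the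
cube-free integers, we may write each value of `d` uniquely in the form `d = ef²` where `e` and `f` are
coprime and square-free. We then have `l(d) ≪ d^ε e^{−1}` by (2.18) and (2.19)", and p. 29 (`|l(d)| ≪ N^ε`
in (7.15)).  PROVED:

* `abs_lOne_mul_le` (`p|l(p)| ≤ 4`), `abs_lTwo_le` (`|l(p²)| ≤ 2`), `abs_lpp_le_two`, `lpp_eq_zero_of_three_le`;
* **`abs_lFun_le_two_pow`** — `|l(d)| ≤ 2^{ω(d)}`, and `two_pow_omega_le_card_divisors` (`2^{ω(d)} ≤ τ(d)`);
* `radOne d = ∏_{p ∥ d} p` (the `e` of `d = ef²`), `radTwo d = ∏_{p² ∥ d} p` (the `f`),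
  `radOne_mul_radTwo_sq` (`e f² = d` when `l(d) ≠ 0`), **`abs_lFun_mul_radOne_le`** — `e |l(d)| ≤ 4^{ω(d)}`.

## References

* D. R. Heath-Brown, *The largest prime factor of `X³ + 2`*, Proc. London Math. Soc. (3) 82 (2001)
  554–596, (2.18)–(2.19) p. 11, §7 pp. 27, 29. [`HeathBrown2001LargestPrimeFactorCubic`]

## Mathlib / tree search

Tree: `lOne`, `lTwo`, `lpp`, `lFun`, `lFun_apply` (`…LnuSeries`/`…EulerIdentity`),
`CubicPrimes.cubeRootTwoCount_two/_three`, `cubeRootTwoCount_mem` (`…Splitting`).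
Mathlib: `Nat.card_divisors`, `Finset.prod_le_prod`, `Finset.abs_prod`, `Nat.factorization_prod_pow_eq_self`,
`Finset.prod_filter_mul_prod_filter_not`, `Finset.prod_const`, `Finset.prod_pow`.
-/

noncomputable section

open Finset Real

namespace Literature.NumberTheory.Sieve.HeathBrown2001

open CubicPrimes

/-! ### Local bounds -/

/-- `p |l(p)| ≤ 4` at every prime. [cite: HeathBrown2001LargestPrimeFactorCubic, (2.18)–(2.19)] -/
theorem abs_lOne_mul_le {p : ℕ} (hp : p.Prime) : (p : ℝ) * |lOne p| ≤ 4 := by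
  unfold lOne
  rcases lt_or_ge p 5 with hlt | h5
  · have := hp.two_le
    interval_cases p
    · rw [if_neg (by norm_num), cubeRootTwoCount_two]; norm_num
    · rw [if_pos rfl]; norm_num
    · exact absurd hp (by decide)
  · have hp3 : p ≠ 3 := by omega
    rw [if_neg hp3]
    have hp5 : (5 : ℝ) ≤ p := by exact_mod_cast h5
    rcases cubeRootTwoCount_mem hp h5 with h | h | h
    · rw [h]; push_cast
      rw [show ((0 : ℝ) - 2) / ((p : ℝ) - 0) = -(2 / p) by rw [sub_zero, zero_sub, neg_div], abs_neg,
        abs_of_pos (by positivity), mul_div_cancel₀ _ (by positivity)]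
      norm_num
    · rw [h]; push_cast
      rw [show ((1 : ℝ) - 2) / ((p : ℝ) - 1) = -(1 / (p - 1)) by field_simp; ring, abs_neg,
        abs_of_pos (by apply div_pos one_pos; linarith), mul_one_div, div_le_iff₀ (by linarith)]
      linarith
    · rw [h]; push_cast
      rw [show ((3 : ℝ) - 2) / ((p : ℝ) - 3) = 1 / (p - 3) by ring,
        abs_of_pos (by apply div_pos one_pos; linarith), mul_one_div, div_le_iff₀ (by linarith)]
      linarith

/-- `|l(p²)| ≤ 2` at every prime. [cite: HeathBrown2001LargestPrimeFactorCubic, (2.18)–(2.19)] -/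
theorem abs_lTwo_le {p : ℕ} (hp : p.Prime) : |lTwo p| ≤ 2 := by
  unfold lTwo
  rcases lt_or_ge p 5 with hlt | h5
  · have := hp.two_le
    interval_cases p
    · rw [if_neg (by norm_num), cubeRootTwoCount_two]; norm_num
    · rw [if_pos rfl]; norm_num
    · exact absurd hp (by decide)
  · have hp3 : p ≠ 3 := by omega
    rw [if_neg hp3]
    have hp5 : (5 : ℝ) ≤ p := by exact_mod_cast h5
    have hg3 : (cubeRootTwoCount p : ℝ) ≤ 3 := by exact_mod_cast cubeRootTwoCount_le_three hp
    have hden : 0 < (p : ℝ) - cubeRootTwoCount p := by linarith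
    rw [neg_div, abs_neg, abs_div, abs_of_pos (by linarith : (0 : ℝ) < p - 2), abs_of_pos hden,
      div_le_iff₀ hden]
    linarith

/-- `|l(p)| ≤ 1`. [folklore] -/
theorem abs_lOne_le_one {p : ℕ} (hp : p.Prime) : |lOne p| ≤ 1 := by
  have h := abs_lOne_mul_le hp
  rcases lt_or_ge p 5 with hlt | h5
  · unfold lOne
    have := hp.two_le
    interval_cases p
    · rw [if_neg (by norm_num), cubeRootTwoCount_two]; norm_num
    · rw [if_pos rfl]; norm_num
    · exact absurd hp (by decide)
  · have hp5 : (5 : ℝ) ≤ p := by exact_mod_cast h5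
    have ha := abs_nonneg (lOne p)
    nlinarith

/-- `|lpp p e| ≤ 2`. [folklore] -/
theorem abs_lpp_le_two {p : ℕ} (hp : p.Prime) (e : ℕ) : |lpp p e| ≤ 2 := by
  unfold lpp
  split_ifs
  · norm_num
  · exact (abs_lOne_le_one hp).trans (by norm_num)
  · exact abs_lTwo_le hp
  · norm_num

/-- `lpp p e = 0` for `e ≥ 3`. [folklore] -/
theorem lpp_eq_zero_of_three_le (p : ℕ) {e : ℕ} (he : 3 ≤ e) : lpp p e = 0 := by
  unfold lpp; rw [if_neg (by omega), if_neg (by omega), if_neg (by omega)]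

/-! ### `|l(d)| ≤ 2^{ω(d)} ≤ τ(d)` -/

/-- **`|l(d)| ≤ 2^{ω(d)}`**. [cite: HeathBrown2001LargestPrimeFactorCubic, §7 p. 29 (|l(d)| ≪ N^ε)] -/
theorem abs_lFun_le_two_pow (d : ℕ) : |lFun d| ≤ (2 : ℝ) ^ d.primeFactors.card := by
  rcases Nat.eq_zero_or_pos d with rfl | hd
  · simp
  rw [lFun_apply hd.ne', abs_prod, ← prod_const]
  exact prod_le_prod (fun p _ => abs_nonneg _) fun p hp => abs_lpp_le_two (Nat.prime_of_mem_primeFactors hp) _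

/-- `2^{ω(d)} ≤ τ(d)` for `d ≠ 0`. [folklore] -/
theorem two_pow_omega_le_card_divisors {d : ℕ} (hd : d ≠ 0) : 2 ^ d.primeFactors.card ≤ #d.divisors := by
  rw [Nat.card_divisors hd, ← prod_const]
  refine prod_le_prod' fun p hp => ?_
  have : 0 < d.factorization p := Nat.Prime.factorization_pos_of_dvd (Nat.prime_of_mem_primeFactors hp) hd
    (Nat.dvd_of_mem_primeFactors hp)
  omega

/-- Hence `|l(d)| ≤ τ(d)` (`d ≠ 0`). [cite: HeathBrown2001LargestPrimeFactorCubic, §7 p. 29] -/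
theorem abs_lFun_le_card_divisors {d : ℕ} (hd : d ≠ 0) : |lFun d| ≤ #d.divisors := by
  refine (abs_lFun_le_two_pow d).trans ?_
  exact_mod_cast two_pow_omega_le_card_divisors hd

/-! ### `d = e f²` and `e |l(d)| ≤ 4^{ω(d)}` -/

/-- `∏_{p ∣ d} p^{v_p(d)} = d` (`d ≠ 0`). [folklore] -/
theorem prod_primeFactors_pow {d : ℕ} (hd : d ≠ 0) : ∏ p ∈ d.primeFactors, p ^ d.factorization p = d := by
  have h := Nat.prod_factorization_pow_eq_self hd
  rwa [Finsupp.prod, Nat.support_factorization] at h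

/-- The square-free part `e = ∏_{p ∥ d} p` of a cube-free `d = ef²`. [cite: HeathBrown2001LargestPrimeFactorCubic, §7 p. 27] -/
def radOne (d : ℕ) : ℕ := ∏ p ∈ d.primeFactors.filter (fun p => d.factorization p = 1), p

/-- The part `f = ∏_{p² ∥ d} p` of a cube-free `d = ef²`. [cite: HeathBrown2001LargestPrimeFactorCubic, §7 p. 27] -/
def radTwo (d : ℕ) : ℕ := ∏ p ∈ d.primeFactors.filter (fun p => d.factorization p = 2), p

/-- Auxiliary fact `radOne_pos` for this file's estimates. [folklore] -/
theorem radOne_pos (d : ℕ) : 0 < radOne d :=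
  prod_pos fun _ hp => (Nat.prime_of_mem_primeFactors (mem_filter.mp hp).1).pos

/-- Auxiliary fact `radTwo_pos` for this file's estimates. [folklore] -/
theorem radTwo_pos (d : ℕ) : 0 < radTwo d :=
  prod_pos fun _ hp => (Nat.prime_of_mem_primeFactors (mem_filter.mp hp).1).pos

/-- `radOne d ∣ d` and `radTwo d ^ 2 ∣ d`. [folklore] -/
theorem radOne_dvd (d : ℕ) : radOne d ∣ d ∧ radTwo d ^ 2 ∣ d := by
  rcases Nat.eq_zero_or_pos d with rfl | hd
  · simp
  constructor
  · unfold radOne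
    have : ∏ p ∈ d.primeFactors.filter (fun p => d.factorization p = 1), p =
        ∏ p ∈ d.primeFactors.filter (fun p => d.factorization p = 1), p ^ d.factorization p :=
      prod_congr rfl fun p hp => by rw [(mem_filter.mp hp).2, pow_one]
    rw [this]
    calc ∏ p ∈ d.primeFactors.filter (fun p => d.factorization p = 1), p ^ d.factorization p
        ∣ ∏ p ∈ d.primeFactors, p ^ d.factorization p := prod_dvd_prod_of_subset _ _ _ (filter_subset _ _)
      _ = d := prod_primeFactors_pow hd.ne'
  · unfold radTwo
    rw [← prod_pow]
    have : ∏ p ∈ d.primeFactors.filter (fun p => d.factorization p = 2), p ^ 2 =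
        ∏ p ∈ d.primeFactors.filter (fun p => d.factorization p = 2), p ^ d.factorization p :=
      prod_congr rfl fun p hp => by rw [(mem_filter.mp hp).2]
    rw [this]
    calc ∏ p ∈ d.primeFactors.filter (fun p => d.factorization p = 2), p ^ d.factorization p
        ∣ ∏ p ∈ d.primeFactors, p ^ d.factorization p := prod_dvd_prod_of_subset _ _ _ (filter_subset _ _)
      _ = d := prod_primeFactors_pow hd.ne'

/-- If `l(d) ≠ 0` then `d` is cube-free and `d = e f²`. [cite: HeathBrown2001LargestPrimeFactorCubic, §7 p. 27] -/
theorem radOne_mul_radTwo_sq {d : ℕ} (hd : d ≠ 0) (hl : lFun d ≠ 0) : radOne d * radTwo d ^ 2 = d := by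
  -- every exponent is `1` or `2`
  have hexp : ∀ p ∈ d.primeFactors, d.factorization p = 1 ∨ d.factorization p = 2 := by
    intro p hp
    have hpos : 0 < d.factorization p := Nat.Prime.factorization_pos_of_dvd (Nat.prime_of_mem_primeFactors hp) hd
      (Nat.dvd_of_mem_primeFactors hp)
    by_contra hne
    have h3 : 3 ≤ d.factorization p := by omega
    apply hl
    rw [lFun_apply hd]
    exact prod_eq_zero hp (lpp_eq_zero_of_three_le p h3)
  unfold radOne radTwo
  rw [← prod_pow]
  have h1 : ∏ p ∈ d.primeFactors.filter (fun p => d.factorization p = 1), p =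
      ∏ p ∈ d.primeFactors.filter (fun p => d.factorization p = 1), p ^ d.factorization p :=
    prod_congr rfl fun p hp => by rw [(mem_filter.mp hp).2, pow_one]
  have h2 : ∏ p ∈ d.primeFactors.filter (fun p => d.factorization p = 2), p ^ 2 =
      ∏ p ∈ d.primeFactors.filter (fun p => ¬ d.factorization p = 1), p ^ d.factorization p := by
    have hset : d.primeFactors.filter (fun p => d.factorization p = 2) =
        d.primeFactors.filter (fun p => ¬ d.factorization p = 1) := by
      refine filter_congr fun p hp => ?_
      rcases hexp p hp with h | h <;> simp [h]
    rw [hset]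
    refine prod_congr rfl fun p hp => ?_
    rw [mem_filter] at hp
    rcases hexp p hp.1 with h | h
    · exact absurd h hp.2
    · rw [h]
  rw [h1, h2, prod_filter_mul_prod_filter_not, prod_primeFactors_pow hd]

/-- **`e |l(d)| ≤ 4^{ω(d)}`** (`l(d) ≪ d^ε e^{−1}`). [cite: HeathBrown2001LargestPrimeFactorCubic, §7 p. 27] -/
theorem abs_lFun_mul_radOne_le (d : ℕ) : (radOne d : ℝ) * |lFun d| ≤ (4 : ℝ) ^ d.primeFactors.card := by
  classical
  rcases Nat.eq_zero_or_pos d with rfl | hd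
  · simp [radOne]
  rw [lFun_apply hd.ne', abs_prod]
  -- write `radOne` as a product over all prime factors of `if v = 1 then p else 1`
  have hrad : (radOne d : ℝ) = ∏ p ∈ d.primeFactors, (if d.factorization p = 1 then (p : ℝ) else 1) := by
    unfold radOne
    push_cast
    rw [prod_filter]
  rw [hrad, ← prod_mul_distrib, ← prod_const]
  refine prod_le_prod (fun p _ => by positivity) fun p hp => ?_
  have hpP := Nat.prime_of_mem_primeFactors hp
  split_ifs with h1
  · rw [h1]
    unfold lpp
    rw [if_neg one_ne_zero, if_pos rfl]
    exact abs_lOne_mul_le hpP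
  · rw [one_mul]
    exact (abs_lpp_le_two hpP _).trans (by norm_num)

end Literature.NumberTheory.Sieve.HeathBrown2001
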